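import Summits.KontsevichZagierPeriods.KontsevichZagierPeriods.Theorems.RootDecompZetaThreeFrontierWordPackaging

/-!
# Route RootDecompZetaThreeFrontier — kernel edge `GZNormalFormWThree → GenusZeroThreeNormalForm` — part 3/3 (`…WordEdge`): word closure at weight ≤ 3 and the edge BY NAME

`wordClosureNFThree_of : DivergenceLEThree → DualityThree → WordClosureNFThree` (every generator of `wordGensLE 3` reduces, modulo `KZ.relations`,
to a triple `[k0 A] + [k2 Q] + [k3 q]`: non-convergent words have coefficient `0` by the divergence fact, `ω₀ω₁ω₁ ~ ω₀ω₀ω₁` by duality, the rest is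
word bookkeeping), the two move facts imported from the landed `…Theorems.RootDecompZetaThreeFrontierWordMoves` (`divergenceLEThree`, `dualityThree`,
whose types are `DivergenceLEThree` and `DualityThree'` on the nose), and the edge
`genusZeroThreeNormalForm_of_gzNormalFormWThree : Theses.RootDecompZetaThreeFrontier.GZNormalFormWThree → Theses.RootDecompZetaThreeFrontier.GenusZeroThreeNormalForm`
— item 28709 from its born rank-9 support ALONE.  [Kontsevich–Zagier 2001 §1.2; Zagier 1994 §9 (duality)]  Standard axioms, 0 sorry.
-/

noncomputable section

set_option linter.dupNamespace false

open Set MeasureTheory MvPolynomial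
open Literature.NumberTheory.Transcendental
open Literature.ModelTheory.ExponentialFields (IsSemialgebraic)
open Summit.KontsevichZagierPeriods.KontsevichZagierPeriods.Theses.RootDecompZetaThreeFrontier
open Summit.KontsevichZagierPeriods.KontsevichZagierPeriods.Theorems.RootDecompZetaThreeFrontierSupportCollapse
open Summit.KontsevichZagierPeriods.KontsevichZagierPeriods.Theorems.RootDecompZetaThreeFrontierWordMoves

namespace Summit.KontsevichZagierPeriods.KontsevichZagierPeriods.Theorems.RootDecompZetaThreeFrontierWordEdge

variable {w N : ℕ}

/-- A representation whose integrand vanishes on its domain is a relation (rule 1b: `f = f + f`). -/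
private theorem of_mem_relations_of_integrand_zero {n : ℕ} (z : KZ.IntegralRep n)
    (hz : ∀ x ∈ z.domain, z.integrand x = 0) : KZ.of z ∈ KZ.relations := by
  have h3 : KZ.of z - KZ.of z - KZ.of z ∈ KZ.relations :=
    KZ.integrandAddRel_subset_relations ⟨n, z, z, z, rfl, rfl, fun x hx => by simp [hz x hx], rfl⟩
  rw [show KZ.of z - KZ.of z - KZ.of z = -KZ.of z by abel] at h3
  exact neg_mem_iff.mp h3

/-- **Divergence below weight 4** [tree theorem BY NAME; weight 1 proved in §12]. -/
def DivergenceLEThree : Prop :=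
  ∀ (w : ℕ) (ε : Fin (w + 1) → Bool) (q : ℚ) (s : KZ.IntegralRep (w + 1)), w + 1 ≤ 3 →
    (ε 0 = true ∨ ε (Fin.last w) = false) →
    s.domain = {t | (∀ i, 0 < t i) ∧ (∀ i, t i < 1) ∧ StrictAnti t} →
    EqOn s.integrand (fun t => (q : ℝ) * ∏ i, if ε i then 1 / (1 - t i) else 1 / t i) s.domain → q = 0

/-- **Duality at weight 3 inside the calculus** [tree theorem BY NAME: `cDual3`]. -/
def DualityThree : Prop :=
  ∀ (q : ℚ) (s : KZ.IntegralRep 3), s.domain = {t | (∀ i, 0 < t i) ∧ (∀ i, t i < 1) ∧ StrictAnti t} →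
    EqOn s.integrand (fun t => (q : ℝ) * ∏ i, if (![false, true, true] : Fin 3 → Bool) i then 1 / (1 - t i)
      else 1 / t i) s.domain →
    KZ.of s - KZ.of (k3 q) ∈ KZ.relations

/-- rule 1b on canonical representatives: coefficients add -/
theorem of_canonA_add (u : List ℕ) (hu : MZV.IsAdmissible u) (a a' : ℚ) :
    KZ.of (canonA u hu (a + a')) - KZ.of (canonA u hu a) - KZ.of (canonA u hu a') ∈ KZ.relations :=
  KZ.integrandAddRel_subset_relations ⟨_, canonA u hu (a + a'), canonA u hu a, canonA u hu a', rfl, rfl,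
    fun t _ => by simp only [canonA_integrand, Pi.add_apply]; push_cast; ring, rfl⟩

/-- the zero coefficient is a relation -/
theorem of_canonA_zero_mem (u : List ℕ) (hu : MZV.IsAdmissible u) : KZ.of (canonA u hu 0) ∈ KZ.relations :=
  of_mem_relations_of_integrand_zero _ fun t _ => by simp [canonA_integrand]

/-- … and negate -/
theorem of_canonA_neg (u : List ℕ) (hu : MZV.IsAdmissible u) (a : ℚ) :
    KZ.of (canonA u hu (-a)) + KZ.of (canonA u hu a) ∈ KZ.relations := by
  have h := of_canonA_add u hu (-a) a
  rw [neg_add_cancel] at h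
  have e : KZ.of (canonA u hu (-a)) + KZ.of (canonA u hu a) =
      KZ.of (canonA u hu 0) - (KZ.of (canonA u hu 0) - KZ.of (canonA u hu (-a)) - KZ.of (canonA u hu a)) := by
    abel
  rw [e]
  exact sub_mem (of_canonA_zero_mem u hu) h

/-- a word representation with coefficient `0` is a relation -/
theorem of_mem_relations_of_coeff_zero {w : ℕ} (ε : Fin w → Bool) (s : KZ.IntegralRep w)
    (hi : EqOn s.integrand (fun t => ((0 : ℚ) : ℝ) * ∏ i, if ε i then 1 / (1 - t i) else 1 / t i) s.domain) :
    KZ.of s ∈ KZ.relations :=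
  of_mem_relations_of_integrand_zero s fun t ht => by rw [hi ht]; simp

/-- letters of an admissible weight-2 word -/
theorem word_eq_two {ε : Fin 2 → Bool} (h0 : ε 0 = false) (h1 : ε 1 = true) :
    ∀ i : Fin 2, (MZV.binaryWord [2]).getD i false = ε i := by
  intro i
  rw [binaryWord_two i]
  fin_cases i <;> simp [h0, h1]

/-- letters of the admissible weight-3 word `ω₀ω₀ω₁` -/
theorem word_eq_three {ε : Fin 3 → Bool} (h0 : ε 0 = false) (h1 : ε 1 = false) (h2 : ε 2 = true) :
    ∀ i : Fin 3, (MZV.binaryWord [3]).getD i false = ε i := by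
  intro i
  rw [binaryWord_three i]
  fin_cases i <;> simp [h0, h1, h2]

/-- letters of the admissible weight-3 word `ω₀ω₁ω₁` -/
theorem word_eq_twoOne {ε : Fin 3 → Bool} (h0 : ε 0 = false) (h1 : ε 1 = true) (h2 : ε 2 = true) :
    ε = ![false, true, true] := by
  funext i
  fin_cases i <;> simp [h0, h1, h2]

/-- bookkeeping: a single canonical slot plus zeros -/
private theorem triple_of_slot (x : KZ.FormalRep) (A Q q : ℚ)
    (h : x - KZ.of (k0 A) - KZ.of (k2 Q) - KZ.of (k3 q) ∈ KZ.relations) :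
    ∃ A Q q : ℚ, x - (KZ.of (k0 A) + KZ.of (k2 Q) + KZ.of (k3 q)) ∈ KZ.relations :=
  ⟨A, Q, q, by rw [show x - (KZ.of (k0 A) + KZ.of (k2 Q) + KZ.of (k3 q)) =
    x - KZ.of (k0 A) - KZ.of (k2 Q) - KZ.of (k3 q) by abel]; exact h⟩

/-- **`WordClosureNFThree` from divergence (`w ≤ 3`) and duality (`w = 3`).** -/
theorem wordClosureNFThree_of (hD : DivergenceLEThree) (hU : DualityThree) : WordClosureNFThree := by
  have z0 : KZ.of (k0 0) ∈ KZ.relations := of_canonA_zero_mem [] adm_nil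
  have z2 : KZ.of (k2 0) ∈ KZ.relations := of_canonA_zero_mem [2] MZV.isAdmissible_two
  have z3 : KZ.of (k3 0) ∈ KZ.relations := of_canonA_zero_mem [3] MZV.isAdmissible_three
  -- a generator with coefficient forced to `0` contributes the zero triple
  have zero_slot : ∀ {w : ℕ} (ε : Fin w → Bool) (s : KZ.IntegralRep w),
      EqOn s.integrand (fun t => ((0 : ℚ) : ℝ) * ∏ i, if ε i then 1 / (1 - t i) else 1 / t i) s.domain →
      ∃ A Q q : ℚ, KZ.of s - (KZ.of (k0 A) + KZ.of (k2 Q) + KZ.of (k3 q)) ∈ KZ.relations :=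
    fun ε s hi => triple_of_slot _ 0 0 0
      (sub_mem (sub_mem (sub_mem (of_mem_relations_of_coeff_zero ε s hi) z0) z2) z3)
  intro m hm
  induction hm using AddSubgroup.closure_induction with
  | mem x hx =>
    obtain ⟨w, ε, q, s, hw, hd, hi, rfl⟩ := hx
    rcases w with _ | _ | _ | _ | w
    · -- weight 0: the constant `[pt, q]`
      refine triple_of_slot _ q 0 0 (sub_mem (sub_mem ?_ z2) z3)
      exact sub_k0_mem q s hd fun t ht => by rw [hi ht]; simp
    · -- weight 1: never admissible
      have hq : q = 0 := by
        refine hD 0 ε q s (by norm_num) ?_ hd hi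
        cases h : ε 0
        · exact Or.inr h
        · exact Or.inl rfl
      subst hq
      exact zero_slot ε s hi
    · -- weight 2: admissible iff `ε = ω₀ω₁`
      by_cases h0 : ε 0 = true
      · have hq : q = 0 := hD 1 ε q s (by norm_num) (Or.inl h0) hd hi
        subst hq
        exact zero_slot ε s hi
      by_cases h1 : ε 1 = true
      · have hc : KZ.of s - KZ.of (k2 q) ∈ KZ.relations :=
          (congr_canonA [2] MZV.isAdmissible_two ε (word_eq_two (eq_false_of_ne_true h0) h1) q s hd hi).1
        refine triple_of_slot _ 0 q 0 ?_
        rw [show KZ.of s - KZ.of (k0 0) - KZ.of (k2 q) - KZ.of (k3 0) =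
          (KZ.of s - KZ.of (k2 q)) - KZ.of (k0 0) - KZ.of (k3 0) by abel]
        exact sub_mem (sub_mem hc z0) z3
      · have hq : q = 0 := hD 1 ε q s (by norm_num) (Or.inr (eq_false_of_ne_true h1)) hd hi
        subst hq
        exact zero_slot ε s hi
    · -- weight 3: admissible iff `ε 0 = ω₀`, `ε 2 = ω₁`; then `ω₀ω₀ω₁` (canonical) or `ω₀ω₁ω₁` (duality)
      by_cases h0 : ε 0 = true
      · have hq : q = 0 := hD 2 ε q s (by norm_num) (Or.inl h0) hd hi
        subst hq
        exact zero_slot ε s hi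
      by_cases h2 : ε 2 = true
      · have hc : KZ.of s - KZ.of (k3 q) ∈ KZ.relations := by
          by_cases h1 : ε 1 = true
          · refine hU q s hd fun t ht => ?_
            rw [hi ht, word_eq_twoOne (eq_false_of_ne_true h0) h1 h2]
          · exact (congr_canonA [3] MZV.isAdmissible_three ε
              (word_eq_three (eq_false_of_ne_true h0) (eq_false_of_ne_true h1) h2) q s hd hi).1
        refine triple_of_slot _ 0 0 q ?_
        rw [show KZ.of s - KZ.of (k0 0) - KZ.of (k2 0) - KZ.of (k3 q) =
          (KZ.of s - KZ.of (k3 q)) - KZ.of (k0 0) - KZ.of (k2 0) by abel]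
        exact sub_mem (sub_mem hc z0) z2
      · have hq : q = 0 := hD 2 ε q s (by norm_num) (Or.inr (eq_false_of_ne_true h2)) hd hi
        subst hq
        exact zero_slot ε s hi
    · -- weight ≥ 4: excluded
      omega
  | zero =>
    refine ⟨0, 0, 0, ?_⟩
    rw [zero_sub]
    exact neg_mem (add_mem (add_mem z0 z2) z3)
  | add x y _ _ ihx ihy =>
    obtain ⟨A, Q, q, hx⟩ := ihx
    obtain ⟨A', Q', q', hy⟩ := ihy
    refine ⟨A + A', Q + Q', q + q', ?_⟩
    have e : x + y - (KZ.of (k0 (A + A')) + KZ.of (k2 (Q + Q')) + KZ.of (k3 (q + q'))) =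
        (x - (KZ.of (k0 A) + KZ.of (k2 Q) + KZ.of (k3 q))) + (y - (KZ.of (k0 A') + KZ.of (k2 Q') + KZ.of (k3 q'))) -
        ((KZ.of (k0 (A + A')) - KZ.of (k0 A) - KZ.of (k0 A')) +
          (KZ.of (k2 (Q + Q')) - KZ.of (k2 Q) - KZ.of (k2 Q')) +
          (KZ.of (k3 (q + q')) - KZ.of (k3 q) - KZ.of (k3 q'))) := by abel
    rw [e]
    exact sub_mem (add_mem hx hy) (add_mem (add_mem (of_canonA_add [] adm_nil A A')
      (of_canonA_add [2] MZV.isAdmissible_two Q Q')) (of_canonA_add [3] MZV.isAdmissible_three q q'))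
  | neg x _ ih =>
    obtain ⟨A, Q, q, hx⟩ := ih
    refine ⟨-A, -Q, -q, ?_⟩
    have e : -x - (KZ.of (k0 (-A)) + KZ.of (k2 (-Q)) + KZ.of (k3 (-q))) =
        -(x - (KZ.of (k0 A) + KZ.of (k2 Q) + KZ.of (k3 q))) -
        ((KZ.of (k0 (-A)) + KZ.of (k0 A)) + (KZ.of (k2 (-Q)) + KZ.of (k2 Q)) + (KZ.of (k3 (-q)) + KZ.of (k3 q))) := by
      abel
    rw [e]
    exact sub_mem (neg_mem hx) (add_mem (add_mem (of_canonA_neg [] adm_nil A) (of_canonA_neg [2] MZV.isAdmissible_two Q))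
      (of_canonA_neg [3] MZV.isAdmissible_three q))

/-- **Item 28709 reduced to the dimension-3 normal form and the two weight-`≤ 3` move facts.** -/
theorem genusZeroThreeNormalForm_of_moves (hN : GZNormalFormW 3) (hD : DivergenceLEThree) (hU : DualityThree) :
    Summit.KontsevichZagierPeriods.KontsevichZagierPeriods.Theses.RootDecompZetaThreeFrontier.GenusZeroThreeNormalForm :=
  genusZeroThreeNormalForm_of_two hN (wordClosureNFThree_of hD hU)

/-- **Duality at weight 3**, route vocabulary: `[Δ₃, q·ω₀ω₁ω₁] ≡ [Δ₃, q·ω₀ω₀ω₁]` for ANY representative `z`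
of the right-hand side. -/
def DualityThree' : Prop :=
  ∀ (q : ℚ) (s z : KZ.IntegralRep 3), s.domain = {t | (∀ i, 0 < t i) ∧ (∀ i, t i < 1) ∧ StrictAnti t} →
    Set.EqOn s.integrand (fun t => (q : ℝ) * ∏ i, if (![false, true, true] : Fin 3 → Bool) i then
      1 / (1 - t i) else 1 / t i) s.domain →
    z.domain = {t | (∀ i, 0 < t i) ∧ (∀ i, t i < 1) ∧ StrictAnti t} →
    Set.EqOn z.integrand (fun t => (q : ℝ) / (t 0 * t 1 * (1 - t 2))) z.domain →
    KZ.of s - KZ.of z ∈ KZ.relations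

/-- (decomp-kz lens-1, `WordLayer.lean` g9) `dualityThree'_iff`. -/
theorem dualityThree'_iff : DualityThree' ↔ DualityThree := by
  constructor
  · intro h q s hd hi
    exact h q s (k3 q) hd hi (k3_domain q) (fun t _ => k3_integrand' q t)
  · intro h q s z hd hi hzd hzi
    have h1 := h q s hd hi
    have h2 := sub_k3_mem q z hzd hzi
    have e : KZ.of s - KZ.of z = (KZ.of s - KZ.of (k3 q)) - (KZ.of z - KZ.of (k3 q)) := by abel
    rw [e]
    exact sub_mem h1 h2

/-- **Item 28709 from the three route-vocabulary statements** (dimension-3 normal form, divergence at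
weight `≤ 3`, duality at weight 3) — `PackagingTwo` being a theorem (§11d). -/
theorem genusZeroThreeNormalForm_of_moves' (hN : GZNormalFormWThree') (hD : DivergenceLEThree)
    (hU : DualityThree') :
    Summit.KontsevichZagierPeriods.KontsevichZagierPeriods.Theses.RootDecompZetaThreeFrontier.GenusZeroThreeNormalForm :=
  genusZeroThreeNormalForm_of_moves (gzNormalFormWThree'_iff.1 hN) hD (dualityThree'_iff.1 hU)

/-- The divergence fact at weight `≤ 3`, imported from the landed move file (types agree on the nose). -/
theorem divergenceLEThree_holds : DivergenceLEThree :=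
  Summit.KontsevichZagierPeriods.KontsevichZagierPeriods.Theorems.RootDecompZetaThreeFrontierWordMoves.divergenceLEThree

/-- The duality fact at weight `3` (cancellation-free form), imported from the landed move file. -/
theorem dualityThree'_holds : DualityThree' :=
  Summit.KontsevichZagierPeriods.KontsevichZagierPeriods.Theorems.RootDecompZetaThreeFrontierWordMoves.dualityThree

/-- `WordClosureNFThree` is a THEOREM: word closure at weight `≤ 3` from the two landed move facts. -/
theorem wordClosureNFThree_holds : WordClosureNFThree :=
  wordClosureNFThree_of divergenceLEThree_holds (dualityThree'_iff.1 dualityThree'_holds)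

/-- **KERNEL EDGE (item 28709 ⟸ its rank-9 support, BY NAME).**  The born support statement
`Theses.RootDecompZetaThreeFrontier.GZNormalFormWThree` (the dimension-`≤ 3` genus-zero normal form: every rational simplex integrand
`P/(∏ tᵢ^{bᵢ} (1-tᵢ)^{cᵢ} ∏_{i<j} (tᵢ-tⱼ)^{aᵢⱼ})` on `Δ_k`, `k ≤ 3`, reduces modulo `KZ.relations` to the closure of `wordGensLE k`) implies the
rank-2 crux `Theses.RootDecompZetaThreeFrontier.GenusZeroThreeNormalForm`; packaging, divergence and duality are theorems. -/
theorem genusZeroThreeNormalForm_of_gzNormalFormWThree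
    (hN : Summit.KontsevichZagierPeriods.KontsevichZagierPeriods.Theses.RootDecompZetaThreeFrontier.GZNormalFormWThree) :
    Summit.KontsevichZagierPeriods.KontsevichZagierPeriods.Theses.RootDecompZetaThreeFrontier.GenusZeroThreeNormalForm :=
  genusZeroThreeNormalForm_of_moves' hN divergenceLEThree_holds dualityThree'_holds

/-- **Registered stub `stub_transfer`** of writer g4's line `gz_transfer` on crux 28709
(SKELETON-REGISTERED 2026-08-30T11:32:45Z; signature verbatim): by name from
`genusZeroThreeNormalForm_of_gzNormalFormWThree` (mechanical alias added at landing, decomp-kz-lander-1 g2). -/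
theorem stub_transfer :
    Summit.KontsevichZagierPeriods.KontsevichZagierPeriods.Theses.RootDecompZetaThreeFrontier.GZNormalFormWThree →
      Summit.KontsevichZagierPeriods.KontsevichZagierPeriods.Theses.RootDecompZetaThreeFrontier.GenusZeroThreeNormalForm :=
  genusZeroThreeNormalForm_of_gzNormalFormWThree

end Summit.KontsevichZagierPeriods.KontsevichZagierPeriods.Theorems.RootDecompZetaThreeFrontierWordEdge
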